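import Literature.NumberTheory.EllipticCurves.Shintani32KohnenConeSums
import Literature.NumberTheory.EllipticCurves.Shintani32Level128Law
import HarnessLib

/-!
# The Kohnen-type theta kernel on the full level-`32` lattice and its level-`128` law (trivial character)

[[cite: Shintani1975, §1 Prop. 1.6, §2 (2.1)]] — for `D ≡ 3 (mod 4)` square-free, the kernel
`𝒦_D(w, z) = 𝒦₃₂[χ_{D*}, 1/D](w, z) = (Im z)^{1/2} ∑_{k ∈ ℤ³} χ_{D*}(Q_k) f_{w, z/D}(ι♮₃₂ k)`
(`Shintani32Kernel.genKernel32` with Kohnen's genus weight `kohnenWt D` of `Shintani32KohnenWeight`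
on ALL coordinates of `L♮₃₂ = {Q_k = [32k₀, k₁, k₂]}` and scale `1/D`, so that the exponents of
the lift are the integers `Δ(k)/D`, with SPLIT orbits at odd exponents — Kohnen's level-`4N`
kernel, W. Kohnen, Math. Ann. 271 (1985), §1) is, in `z`, `θ`-automorphic of weight `3/2` on
`Γ₀(128)` with **trivial** character (`isThetaAutomorphic_kerK`; numerically first:
level exactly `128`, evidence `kernel_kohnen32` in the unit folder).  PROVED here:

1. `kerK_sl_smul` (weight `-2` in `w` under `Γ₀(32)`, `invWeight32_kohnenWt`), `kerK_T_smul`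
   (`D ∣ Δ` on the support);
2. **the Poisson step for EVERY `c ≥ 1`** (`kerK_smul`): for `γ = (a b; c d) ∈ SL₂(ℤ)`, `N = cD`,
   `𝒦_D(w, γz) = (Im γz)^{1/2} (32N³)⁻¹ κ(Z') (64N)⁻¹ ∑_{v ∈ ℤ³} 𝔊_γ(v) f_{w, z/(16384 D)}(ι₃₂ v)`
   — the dual of the full lattice is the SPARSE one `ι₃₂(ℤ³) = {(32v₀, 64v₁, v₂)}` at the small scale
   `1/(16384 D)` (point identity `γz/D = a/(cD) - 1/(N(cz+d))`, `W = N(cz+d)/4`, `μ = (32N, N, N)`,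
   `(64N) S⁻¹(Bm) = ι₃₂(swapNeg m)`, `W/(64N)² = z/(16384D)`), with the Gauss coefficients
   `𝔊_γ(v) = e(d disc ι₃₂(v)/(16384N)) ∑_{r mod N} w_D(r) ψ_N(a Δ(r) + ℓ(r,v))` — no parity
   restriction on `c` (the weight is periodic modulo `D`); this is also the input of the cusp
   analysis of the lift at ALL cusps;
3. **the evaluation at `c = 128`** (`kerK_smul_sigma`): `𝔊_σ` is supported on `v = (128k₀, 2k₁, 128k₂)`
   (`Shintani32KohnenConeSums`), where `ι₃₂(v) = 128 ι♮₃₂(k)` and `f_{w,z/(16384D)}(128x) = 128 f_{w,z/D}(x)`,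
   and equals `𝒦(a,a*) χ_{D*}(Q_k)` with `𝒦(a,a*) = (-a*/D) · 128N · G(a; N)`: the kernel reproduces itself;
4. **the constant identity** (`const_identityK`, `D ≡ 3 (mod 4)`, the `z`-free part `evalConstK_key`:
   `256 √D 𝒦(a,a*) = i N² G(a;128)³`) and the assembly on `Γ₀(128) = ⟨T, -1, (a b; 128 d)⟩`
   (`isThetaAutomorphic_kerK`).

No named facts; definitions `scaleK_pos`, `kerK`, `ptK`, `auxWK`, `muK`, `dualVecK`, `ptSmall`,
`gaussCoefK`, `dblK`, `evalConstK`, `genSetK`.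
-/

noncomputable section

open Complex Real
open scoped MatrixGroups ComplexConjugate

namespace Literature.NumberTheory.EllipticCurves.Shintani

open UpperHalfPlane hiding I
open Literature.NumberTheory.EllipticCurves.ModularForms
open Literature.NumberTheory.EllipticCurves.Tunnell1983 (thetaMul_one_eq_shimuraTheta thetaMul_one_smul)

/-! ### The kernel; the `w`-law and the `T`-law -/

section Kernel

variable (D : ℕ) [NeZero D]

/-- `0 < 1/D`. [folklore] -/
theorem scaleK_pos : (0 : ℝ) < 1 / D := by
  have : (0 : ℝ) < D := by exact_mod_cast Nat.pos_of_ne_zero (NeZero.ne D)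
  positivity

/-- **The Kohnen-type kernel** `𝒦_D(w, z) = 𝒦₃₂[χ_{D*}, 1/D](w, z)`. [cite: Shintani1975, §2 (2.1)] -/
def kerK (w z : ℍ) : ℂ := genKernel32 (fun k ↦ (kohnenWt D k : ℂ)) (1 / D) (scaleK_pos D) w z

/-- The scale as a point map `z ↦ z/D`. [folklore] -/
abbrev ptK (z : ℍ) : ℍ := mulPos (1 / D) (scaleK_pos D) z

/-- The kernel as a series. [folklore] -/
theorem kerK_eq_tsum (w z : ℍ) :
    kerK D w z = (Real.sqrt z.im : ℂ) * ∑' k : Fin 3 → ℤ, (kohnenWt D k : ℂ) *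
      shintaniFn w (ptK D z) (latSharp32 k) := rfl

/-- **Weight `-2` in `w` under `Γ₀(32)`** (`D` odd). [cite: Shintani1975, (2.12)] -/
theorem kerK_sl_smul (hD : Odd D) (γ : SL(2, ℤ)) (hγ : (32 : ℤ) ∣ γ 1 0) (w z : ℍ) :
    kerK D (γ • w) z * (((γ 1 0 : ℤ) : ℂ) * w + ((γ 1 1 : ℤ) : ℂ)) ^ 2 = kerK D w z :=
  genKernel32_sl_smul (invWeight32_kohnenWt hD) _ _ γ hγ w z

/-- **The `T`-law**: `𝒦_D(w, z + 1) = 𝒦_D(w, z)` (`D` square-free): on the support `D ∣ Δ(k)`, so the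
exponents `disc ι♮₃₂(k)/D = Δ(k)/D` are integers. [folklore] -/
theorem kerK_T_smul (hsq : Squarefree D) (w z : ℍ) : kerK D w (ModularGroup.T • z) = kerK D w z := by
  rw [UpperHalfPlane.modular_T_smul]
  unfold kerK
  apply genKernel32_vadd_of_int
  intro k hk
  have hk' : kohnenWt D k ≠ 0 := by exact_mod_cast hk
  have hDn : (D : ℤ) ∣ discK k := by
    by_contra h; exact hk' (kohnenWt_of_not_dvd hsq h)
  obtain ⟨m, hm⟩ := hDn
  refine ⟨m, ?_⟩
  rw [disc_latSharp32_eq_discK, hm]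
  have hD0 : (D : ℝ) ≠ 0 := by exact_mod_cast NeZero.ne D
  push_cast
  field_simp

end Kernel

/-! ### Pieces of the Poisson step (general `c ≥ 1`) -/

section Pieces

open Literature.NumberTheory.EllipticCurves.ModularForms (coe_smul_eq' det_eq_one'
  moebius_eq_sub_inv' im_denom_pos)

/-- The auxiliary point `W = N(cz + d)/4` (`N = cD`). [folklore] -/
def auxWK (N c : ℕ) [NeZero N] [NeZero c] (d : ℤ) (z : ℍ) : ℍ :=
  (((N : ℝ) * d / 4 : ℝ)) +ᵥ mulPos ((N : ℝ) * c / 4) (by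
    have := Nat.pos_of_ne_zero (NeZero.ne N); have := Nat.pos_of_ne_zero (NeZero.ne c)
    positivity) z

/-- `coe_auxWK` (auxiliary). [folklore] -/
theorem coe_auxWK (N c : ℕ) [NeZero N] [NeZero c] (d : ℤ) (z : ℍ) :
    ((auxWK N c d z : ℍ) : ℂ) = (N : ℂ) * ((c : ℂ) * z + d) / 4 := by
  rw [auxWK, UpperHalfPlane.coe_vadd, coe_mulPos]
  push_cast
  ring

/-- `coe_invFour_auxWK` (auxiliary). [folklore] -/
theorem coe_invFour_auxWK (N c : ℕ) [NeZero N] [NeZero c] (d : ℤ) (z : ℍ) :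
    ((invFour (auxWK N c d z) : ℍ) : ℂ) = -1 / (N * ((c : ℂ) * z + d)) := by
  rw [coe_invFour, coe_auxWK]
  have : (4 : ℂ) ≠ 0 := by norm_num
  field_simp

/-- **The point identity** `(γz)/D = a/(Dc) + (-1/(N (cz+d)))`, `N = cD`. [folklore] -/
theorem mulPos_smul_eq_vaddK (D : ℕ) [NeZero D] (γ : SL(2, ℤ)) (c : ℕ) [NeZero c]
    (hc : (γ 1 0 : ℤ) = c) (z : ℍ) :
    mulPos (1 / D) (scaleK_pos D) (γ • z) =
      ((γ 0 0 : ℤ) / (D * c) : ℝ) +ᵥ invFour (auxWK (c * D) c (γ 1 1) z) := by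
  apply UpperHalfPlane.ext
  rw [coe_mulPos, UpperHalfPlane.coe_vadd, coe_invFour_auxWK, coe_smul_eq' γ z, hc, Int.cast_natCast]
  have hdet : ((γ 0 0 : ℤ) : ℂ) * (γ 1 1 : ℤ) - (γ 0 1 : ℤ) * (c : ℂ) = 1 := by
    have := det_eq_one' γ
    rw [hc] at this
    exact_mod_cast this
  have hcz : (c : ℂ) * z + (γ 1 1 : ℤ) ≠ 0 := by
    have := im_denom_pos (c := c) (γ 1 1) z
    intro h; rw [h] at this; simp at this
  have hc0 : (c : ℂ) ≠ 0 := by exact_mod_cast NeZero.ne c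
  have hD0 : (D : ℂ) ≠ 0 := by exact_mod_cast NeZero.ne D
  rw [moebius_eq_sub_inv' hc0 hdet hcz]
  push_cast
  field_simp
  ring

/-! #### Splitting `ℤ³` modulo `N` on the full lattice -/

/-- The scaling vector `μ = (32N, N, N)`. [folklore] -/
def muK (N : ℕ) : Fin 3 → ℝ := ![32 * N, N, N]

/-- `one_le_muK` (auxiliary). [folklore] -/
theorem one_le_muK (N : ℕ) [NeZero N] (i : Fin 3) : 1 ≤ muK N i := by
  have : (1 : ℝ) ≤ N := by exact_mod_cast Nat.pos_of_ne_zero (NeZero.ne N)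
  fin_cases i
  · show (1 : ℝ) ≤ 32 * N; linarith
  · show (1 : ℝ) ≤ N; exact this
  · show (1 : ℝ) ≤ N; exact this

/-- `muK_prod` (auxiliary). [folklore] -/
theorem muK_prod (N : ℕ) : muK N 0 * muK N 1 * muK N 2 = 32 * (N : ℝ) ^ 3 := by
  simp [muK]; ring

/-- `ι♮₃₂(Nq + r̃) = A q + ι♮₃₂(r̃)`, `A = diag(32N, N, N)`. [folklore] -/
theorem latSharp32_splitEquiv (N : ℕ) [NeZero N] (q : Fin 3 → ℤ) (r : Fin 3 → ZMod N) :
    latSharp32 (splitEquiv N (q, r)) =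
      dgLin (muK N) (WithLp.toLp 2 fun i ↦ (q i : ℝ)) + latSharp32 (liftZ r) := by
  ext i
  fin_cases i <;> simp [latSharp32, dgLin_apply, muK, splitEquiv_apply, liftZ]
  ring

/-- `χ_{D*}(Nq + r̃) = χ_{D*}(r̃)` (`D ∣ N`). [folklore] -/
theorem kohnenWt_splitEquiv {D N : ℕ} [NeZero N] (hD : D ∣ N) (q : Fin 3 → ℤ)
    (r : Fin 3 → ZMod N) : kohnenWt D (splitEquiv N (q, r)) = kohnenWt D (liftZ r) := by
  refine kohnenWt_congr (M := N) (by exact_mod_cast hD) fun i ↦ ?_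
  rw [splitEquiv_apply, liftZ]
  exact (Int.modEq_iff_dvd.mpr ⟨-q i, by ring⟩)

/-- `Δ(Nq + r̃) ≡ Δ(r̃) (mod N)`. [folklore] -/
theorem discK_splitEquiv (N : ℕ) [NeZero N] (q : Fin 3 → ℤ) (r : Fin 3 → ZMod N) :
    ∃ m : ℤ, discK (splitEquiv N (q, r)) = discK (liftZ r) + N * m := by
  have h : discK (splitEquiv N (q, r)) ≡ discK (liftZ r) [ZMOD N] := by
    refine discK_emod_congr fun i ↦ ?_
    rw [splitEquiv_apply, liftZ]
    exact (Int.modEq_iff_dvd.mpr ⟨-q i, by ring⟩)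
  obtain ⟨m, hm⟩ := Int.modEq_iff_dvd.mp h.symm
  exact ⟨m, by linear_combination hm⟩

/-! #### The dual side for `diag(32N, N, N)` -/

/-- The dual lattice vector `B m = (m₀/(32N), m₁/N, m₂/N)`. [folklore] -/
def dualVecK (N : ℕ) (m : Fin 3 → ℤ) : V :=
  dgLin (fun i ↦ (muK N i)⁻¹) (WithLp.toLp 2 fun i ↦ (m i : ℝ))

/-- `dualVecK_apply` (auxiliary). [folklore] -/
theorem dualVecK_apply (N : ℕ) (m : Fin 3 → ℤ) (i : Fin 3) : dualVecK N m i = (muK N i)⁻¹ * m i := by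
  rw [dualVecK, dgLin_apply]

/-- `(64N) · S⁻¹(B m) = ι₃₂(swapNeg m)` (the SPARSE lattice). [folklore] -/
theorem smul_sinv_dualVecK (N : ℕ) [NeZero N] (m : Fin 3 → ℤ) :
    ((64 * N : ℝ)) • sinv (dualVecK N m) = latFun32 (swapNeg m) := by
  have hN : (N : ℝ) ≠ 0 := by exact_mod_cast NeZero.ne N
  ext i
  fin_cases i <;> simp [sinv, dualVecK_apply, muK, latFun32] <;> field_simp <;> ring

/-- `disc(S⁻¹(B m)) = disc(ι₃₂(swapNeg m))/(64N)²`. [folklore] -/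
theorem disc_sinv_dualVecK (N : ℕ) [NeZero N] (m : Fin 3 → ℤ) :
    disc (sinv (dualVecK N m)) = disc (latFun32 (swapNeg m)) / (64 * N) ^ 2 := by
  have hN : (0 : ℝ) < 64 * N := by
    have : (0 : ℝ) < N := by exact_mod_cast Nat.pos_of_ne_zero (NeZero.ne N)
    positivity
  rw [← smul_sinv_dualVecK N m, disc_smul, eq_div_iff (by positivity)]
  ring

/-- `⟪ι♮₃₂(r̃), B m⟫ = (r̃₀m₀ + r̃₁m₁ + r̃₂m₂)/N`. [folklore] -/
theorem inner_latSharp32_dualVecK (N : ℕ) [NeZero N] (v m : Fin 3 → ℤ) :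
    @inner ℝ V _ (latSharp32 v) (dualVecK N m) = ((v 0 * m 0 + v 1 * m 1 + v 2 * m 2 : ℤ) : ℝ) / N := by
  have hN : (N : ℝ) ≠ 0 := by exact_mod_cast NeZero.ne N
  rw [inner_eq_sum_three]
  simp only [latSharp32_zero, latSharp32_one, latSharp32_two, dualVecK_apply, muK]
  simp
  field_simp

/-! #### Homogeneity: the small scale `1/(16384 D)` -/

variable (D : ℕ) [NeZero D]

/-- `0 < 1/(16384 D)`. [folklore] -/
theorem scaleSmall_pos : (0 : ℝ) < 1 / (16384 * D) := by
  have : (0 : ℝ) < D := by exact_mod_cast Nat.pos_of_ne_zero (NeZero.ne D)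
  positivity

/-- The small scale as a point map `z ↦ z/(16384 D)`. [folklore] -/
abbrev ptSmall (z : ℍ) : ℍ := mulPos (1 / (16384 * D)) (scaleSmall_pos D) z

/-- `f_{w, z/(16384D)}((64N) • y) = 64N · f_{w, (Nc/4) z}(y)` (`(64N)²/(16384 D) = Nc/4`, `N = cD`).
[folklore] -/
theorem shintaniFn_ptSmall_smul (c : ℕ) [NeZero c] (w z : ℍ) (y : V) :
    shintaniFn w (ptSmall D z) (((64 * (c * D : ℕ) : ℝ)) • y) =
      (64 * (c * D : ℕ) : ℝ) * shintaniFn w (mulPos (((c * D : ℕ) : ℝ) * c / 4) (by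
        have := Nat.pos_of_ne_zero (NeZero.ne c); have := Nat.pos_of_ne_zero (NeZero.ne D)
        positivity) z) y := by
  have hpos : (0 : ℝ) < 64 * (c * D : ℕ) := by
    have := Nat.pos_of_ne_zero (NeZero.ne c); have := Nat.pos_of_ne_zero (NeZero.ne D)
    positivity
  rw [shintaniFn_smul w (ptSmall D z) hpos y]
  congr 2
  rw [ptSmall, mulPos_mulPos]
  apply UpperHalfPlane.ext
  simp only [coe_mulPos]
  have hD : (D : ℂ) ≠ 0 := by exact_mod_cast NeZero.ne D
  push_cast
  field_simp
  ring

/-- The value of `f_{w, W}` (`W = N(cz+d)/4`) at a dual vector, reduced to the small scale: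
`f_{w,W}(S⁻¹Bm) = e(d·disc ι₃₂(k)/(16384 N)) · (64N)⁻¹ · f_{w, z/(16384D)}(ι₃₂(k))`, `k = swapNeg m`.
[folklore] -/
theorem shintaniFn_auxWK_sinv_dualVecK (c : ℕ) [NeZero c] (d : ℤ) (w z : ℍ) (m : Fin 3 → ℤ) :
    shintaniFn w (auxWK (c * D) c d z) (sinv (dualVecK (c * D) m)) =
      eR (d * disc (latFun32 (swapNeg m)) / (16384 * (c * D : ℕ))) *
        (((64 * (c * D : ℕ) : ℝ) : ℂ)⁻¹ * shintaniFn w (ptSmall D z) (latFun32 (swapNeg m))) := by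
  have hN : (0 : ℝ) < (c * D : ℕ) := by exact_mod_cast Nat.pos_of_ne_zero (NeZero.ne (c * D))
  set y : V := sinv (dualVecK (c * D) m) with hy
  have h1 : shintaniFn w (auxWK (c * D) c d z) y =
      cexp (2 * π * I * ((((c * D : ℕ) : ℝ) * d / 4 : ℝ) * disc y)) *
        shintaniFn w (mulPos (((c * D : ℕ) : ℝ) * c / 4) (by
          have := Nat.pos_of_ne_zero (NeZero.ne c); positivity) z) y := by
    unfold auxWK
    rw [shintaniFn_vadd]
  have h2 := shintaniFn_ptSmall_smul D c w z y
  rw [hy, smul_sinv_dualVecK] at h2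
  rw [← hy] at h2
  have h64 : ((64 * (c * D : ℕ) : ℝ) : ℂ) ≠ 0 := by
    have : (0 : ℝ) < 64 * (c * D : ℕ) := by positivity
    exact_mod_cast this.ne'
  have h3 : shintaniFn w (mulPos (((c * D : ℕ) : ℝ) * c / 4) (by
          have := Nat.pos_of_ne_zero (NeZero.ne c); positivity) z) y =
      (((64 * (c * D : ℕ) : ℝ) : ℂ))⁻¹ * shintaniFn w (ptSmall D z) (latFun32 (swapNeg m)) := by
    rw [eq_inv_mul_iff_mul_eq₀ h64, ← h2]
  rw [h1, h3]
  congr 1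
  rw [eR, hy, disc_sinv_dualVecK]
  congr 1
  push_cast
  field_simp
  ring

open scoped FourierTransform RealInnerProductSpace in
/-- **The `q`-sum over the residue class `r`**:
`∑_q f_{w,Z'}(Aq + ι♮₃₂(r̃)) = (32N³)⁻¹ κ(Z') (64N)⁻¹ ∑_k e(ℓ(r̃,k)/N) e(d·disc ι₃₂(k)/(16384N)) f_{w,z/(16384D)}(ι₃₂ k)`,
`Z' = -1/(4W)`. [folklore] -/
theorem tsum_q_residueK (c : ℕ) [NeZero c] (d : ℤ) (w z : ℍ) (r : Fin 3 → ZMod (c * D)) :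
    ∑' q : Fin 3 → ℤ, shintaniFn w (invFour (auxWK (c * D) c d z))
        (dgLin (muK (c * D)) (WithLp.toLp 2 fun i ↦ (q i : ℝ)) + latSharp32 (liftZ r)) =
      (((32 * ((c * D : ℕ) : ℝ) ^ 3)⁻¹ : ℝ) : ℂ) * kappa (invFour (auxWK (c * D) c d z)) *
        (((64 * (c * D : ℕ) : ℝ) : ℂ))⁻¹ *
        ∑' k : Fin 3 → ℤ,
          eR (((-(liftZ r 0) * k 2 + liftZ r 1 * k 1 - liftZ r 2 * k 0 : ℤ) : ℝ) / (c * D : ℕ)) *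
          eR (d * disc (latFun32 k) / (16384 * (c * D : ℕ))) *
          shintaniFn w (ptSmall D z) (latFun32 k) := by
  rw [tsum_shintaniFn_diag (one_le_muK (c * D)) (latSharp32 (liftZ r)) w (invFour (auxWK (c * D) c d z)),
    invFour_invFour, muK_prod, Complex.real_smul]
  have hterm : ∀ m : Fin 3 → ℤ,
      𝐞 (⟪latSharp32 (liftZ r), dgLin (fun i ↦ (muK (c * D) i)⁻¹) (WithLp.toLp 2 fun i ↦ (m i : ℝ))⟫) •
        (kappa (invFour (auxWK (c * D) c d z)) * shintaniFn w (auxWK (c * D) c d z)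
          (sinv (dgLin (fun i ↦ (muK (c * D) i)⁻¹) (WithLp.toLp 2 fun i ↦ (m i : ℝ))))) =
      kappa (invFour (auxWK (c * D) c d z)) * ((((64 * (c * D : ℕ) : ℝ) : ℂ))⁻¹ *
        (eR (((liftZ r 0 * m 0 + liftZ r 1 * m 1 + liftZ r 2 * m 2 : ℤ) : ℝ) / (c * D : ℕ)) *
          eR (d * disc (latFun32 (swapNeg m)) / (16384 * (c * D : ℕ))) *
          shintaniFn w (ptSmall D z) (latFun32 (swapNeg m)))) := by
    intro m
    rw [fourierChar_smul_eq, show dgLin (fun i ↦ (muK (c * D) i)⁻¹) (WithLp.toLp 2 fun i ↦ (m i : ℝ)) =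
      dualVecK (c * D) m from rfl, inner_latSharp32_dualVecK, shintaniFn_auxWK_sinv_dualVecK]
    ring
  simp_rw [hterm]
  rw [tsum_mul_left, tsum_mul_left, ← mul_assoc, ← mul_assoc]
  congr 1
  rw [← swapNegEquiv.tsum_eq]
  refine tsum_congr fun k ↦ ?_
  show eR (((liftZ r 0 * (swapNeg k) 0 + liftZ r 1 * (swapNeg k) 1 + liftZ r 2 * (swapNeg k) 2 : ℤ) : ℝ) /
      (c * D : ℕ)) * eR (d * disc (latFun32 (swapNeg (swapNeg k))) / (16384 * (c * D : ℕ))) *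
      shintaniFn w (ptSmall D z) (latFun32 (swapNeg (swapNeg k))) = _
  rw [swapNeg_swapNeg, swapNeg_zero, swapNeg_one, swapNeg_two]
  congr 3
  push_cast
  ring

/-! ### The Gauss coefficients and the Poisson step -/

/-- **The Gauss coefficient** (`N = cD`, ANY `c ≥ 1`):
`𝔊_γ(k) = e(d · disc ι₃₂(k)/(16384 N)) · ∑_{r ∈ (ℤ/N)³} w_D(r) ψ_N(a Δ(r) + ℓ(r, k))`. [folklore] -/
def gaussCoefK (a d : ℤ) (c : ℕ) [NeZero c] (k : Fin 3 → ℤ) : ℂ :=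
  eR (d * disc (latFun32 k) / (16384 * (c * D : ℕ))) *
    ∑ r : Fin 3 → ZMod (c * D), wDK D r * ZMod.stdAddChar ((a : ZMod (c * D)) * nZK r + ellZ r k)

/-- The Gauss coefficients are bounded. [folklore] -/
theorem bddWeight_gaussCoefK (a d : ℤ) (c : ℕ) [NeZero c] : BddWeight (gaussCoefK D a d c) := by
  refine ⟨(Fintype.card (Fin 3 → ZMod (c * D)) : ℝ), fun k ↦ ?_⟩
  unfold gaussCoefK
  rw [norm_mul, norm_eR, one_mul]
  refine (norm_sum_le _ _).trans ?_
  have : ∀ r : Fin 3 → ZMod (c * D),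
      ‖wDK D r * ZMod.stdAddChar ((a : ZMod (c * D)) * nZK r + ellZ r k)‖ ≤ 1 := fun r ↦ by
    rw [norm_mul, AddChar.norm_apply, mul_one]
    exact norm_wDK_le D r
  calc ∑ r : Fin 3 → ZMod (c * D), ‖wDK D r * ZMod.stdAddChar ((a : ZMod (c * D)) * nZK r + ellZ r k)‖
      ≤ ∑ _r : Fin 3 → ZMod (c * D), (1 : ℝ) := Finset.sum_le_sum fun r _ ↦ this r
    _ = _ := by simp

open Literature.NumberTheory.LFunctions.Fourier (summable_one_add_norm_rpow_neg) in
omit [NeZero D] in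
/-- Summability of the families `k ↦ χ_{D*}(Q_k) u(k) f_{w,Z}(ι♮₃₂ k)` for bounded `u`. [folklore] -/
theorem summable_K_family (u : (Fin 3 → ℤ) → ℂ) (hu : ∀ k, ‖u k‖ ≤ 1) (w Z : ℍ) :
    Summable fun k : Fin 3 → ℤ ↦ (kohnenWt D k : ℂ) * u k * shintaniFn w Z (latSharp32 k) := by
  have h := summable_term32 (c := fun k ↦ (kohnenWt D k : ℂ) * u k) ⟨1, fun k ↦ by
    rw [norm_mul]
    calc ‖(kohnenWt D k : ℂ)‖ * ‖u k‖ ≤ 1 * 1 := by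
          refine mul_le_mul ?_ (hu k) (norm_nonneg _) zero_le_one
          rw [Complex.norm_intCast]; exact_mod_cast abs_kohnenWt_le D k
      _ = 1 := one_mul 1⟩ w Z
  exact h

/-- **The Poisson step for `𝒦_D`, every `c ≥ 1`.** For `γ = (a b; c d) ∈ SL₂(ℤ)` with `c > 0`, `N = cD`:
`𝒦_D(w, γz) = (Im γz)^{1/2} (32N³)⁻¹ κ(Z') (64N)⁻¹ ∑_{k ∈ ℤ³} 𝔊_γ(k) f_{w, z/(16384D)}(ι₃₂(k))`,
`Z' = -1/(N(cz+d))`. [cite: Shintani1975, Prop. 1.6] -/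
theorem kerK_smul (γ : SL(2, ℤ)) (c : ℕ) [NeZero c] (hc : (γ 1 0 : ℤ) = c) (w z : ℍ) :
    kerK D w (γ • z) = (Real.sqrt (γ • z).im : ℂ) *
      ((((32 * ((c * D : ℕ) : ℝ) ^ 3)⁻¹ : ℝ) : ℂ) * kappa (invFour (auxWK (c * D) c (γ 1 1) z)) *
        (((64 * (c * D : ℕ) : ℝ) : ℂ))⁻¹) *
      ∑' k : Fin 3 → ℤ, gaussCoefK D (γ 0 0) (γ 1 1) c k * shintaniFn w (ptSmall D z) (latFun32 k) := by
  set N : ℕ := c * D with hN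
  set a : ℤ := γ 0 0 with ha
  set d : ℤ := γ 1 1 with hd
  have hDN : D ∣ c * D := dvd_mul_left D c
  have hNpos : (0 : ℝ) < (c * D : ℕ) := by exact_mod_cast Nat.pos_of_ne_zero (NeZero.ne (c * D))
  set Z' : ℍ := invFour (auxWK (c * D) c d z) with hZ'
  rw [kerK_eq_tsum, mul_assoc]
  congr 1
  -- Step A: the point identity and the phase `e(a Δ(k)/N)`
  have hP : ptK D (γ • z) = ((a / (D * c) : ℝ)) +ᵥ Z' := mulPos_smul_eq_vaddK D γ c hc z
  have hA : ∀ k : Fin 3 → ℤ, (kohnenWt D k : ℂ) * shintaniFn w (ptK D (γ • z)) (latSharp32 k) =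
      (kohnenWt D k : ℂ) * eR (a * discK k / (c * D : ℕ)) * shintaniFn w Z' (latSharp32 k) := by
    intro k
    rw [hP, shintaniFn_vadd, disc_latSharp32_eq_discK, eR]
    conv_rhs => rw [mul_assoc]
    congr 2
    congr 1
    have hc0 : (c : ℂ) ≠ 0 := by exact_mod_cast NeZero.ne c
    have hD0 : (D : ℂ) ≠ 0 := by exact_mod_cast NeZero.ne D
    push_cast
    field_simp
  simp_rw [hA]
  -- Step B: reindex `k = Nq + r̃`
  set F : (Fin 3 → ℤ) → ℂ := fun k ↦ (kohnenWt D k : ℂ) * eR (a * discK k / (c * D : ℕ)) *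
    shintaniFn w Z' (latSharp32 k) with hF
  have hFs : Summable F := summable_K_family D (fun k ↦ eR (a * discK k / (c * D : ℕ)))
    (fun k ↦ (norm_eR _).le) w Z'
  set e : (Fin 3 → ZMod N) × (Fin 3 → ℤ) ≃ (Fin 3 → ℤ) :=
    (Equiv.prodComm _ _).trans (splitEquiv N) with he
  have he_apply : ∀ r q, e (r, q) = splitEquiv N (q, r) := fun r q ↦ rfl
  have hFe : Summable (F ∘ e) := (e.summable_iff).mpr hFs
  rw [show ∑' k, F k = ∑' p : (Fin 3 → ZMod N) × (Fin 3 → ℤ), (F ∘ e) p from (e.tsum_eq F).symm,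
    hFe.tsum_prod' (fun r ↦ hFe.prod_factor r), tsum_fintype]
  simp only [Function.comp_apply]
  -- Step C: each residue class
  have hC : ∀ r : Fin 3 → ZMod N, ∑' q : Fin 3 → ℤ, F (e (r, q)) =
      (kohnenWt D (liftZ r) : ℂ) * eR (a * discK (liftZ r) / (c * D : ℕ)) *
        ((((32 * ((c * D : ℕ) : ℝ) ^ 3)⁻¹ : ℝ) : ℂ) * kappa Z' * (((64 * (c * D : ℕ) : ℝ) : ℂ))⁻¹ *
        ∑' k : Fin 3 → ℤ,
          eR (((-(liftZ r 0) * k 2 + liftZ r 1 * k 1 - liftZ r 2 * k 0 : ℤ) : ℝ) / (c * D : ℕ)) *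
          eR (d * disc (latFun32 k) / (16384 * (c * D : ℕ))) *
          shintaniFn w (ptSmall D z) (latFun32 k)) := by
    intro r
    have h1 : ∀ q, F (e (r, q)) = (kohnenWt D (liftZ r) : ℂ) * eR (a * discK (liftZ r) / (c * D : ℕ)) *
        shintaniFn w Z' (dgLin (muK N) (WithLp.toLp 2 fun i ↦ (q i : ℝ)) + latSharp32 (liftZ r)) := by
      intro q
      rw [he_apply, hF]
      dsimp only
      rw [kohnenWt_splitEquiv hDN, latSharp32_splitEquiv]
      obtain ⟨m, hm⟩ := discK_splitEquiv N q r
      rw [hm]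
      congr 2
      push_cast
      have hNR : (N : ℝ) = (c : ℝ) * D := by rw [hN]; push_cast; ring
      have hc0 : (c : ℝ) ≠ 0 := by exact_mod_cast NeZero.ne c
      have hD0 : (D : ℝ) ≠ 0 := by exact_mod_cast NeZero.ne D
      have : (a : ℝ) * ((discK (liftZ r) : ℝ) + (N : ℝ) * m) / ((c : ℝ) * D) =
          (a : ℝ) * (discK (liftZ r)) / ((c : ℝ) * D) + ((a * m : ℤ) : ℝ) := by
        rw [hNR]; push_cast; field_simp
      rw [this, eR_add_int]
    simp_rw [h1]
    rw [tsum_mul_left, tsum_q_residueK D c d w z r]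
  simp_rw [hC]
  -- Step D
  have hk_summ : ∀ r : Fin 3 → ZMod N, Summable fun k : Fin 3 → ℤ ↦
      eR (((-(liftZ r 0) * k 2 + liftZ r 1 * k 1 - liftZ r 2 * k 0 : ℤ) : ℝ) / (c * D : ℕ)) *
      eR (d * disc (latFun32 k) / (16384 * (c * D : ℕ))) * shintaniFn w (ptSmall D z) (latFun32 k) := by
    intro r
    -- through the injection `embed32`: a subfamily of a summable family over `ι♮₃₂`
    have h0 := summable_term32 (c := fun k ↦
      eR (((-(liftZ r 0) * k 2 + liftZ r 1 * (k 1 / 64) - liftZ r 2 * k 0 : ℤ) : ℝ) / (c * D : ℕ)) *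
      eR (d * disc (latSharp32 k) / (16384 * (c * D : ℕ)))) ⟨1, fun k ↦ by
        rw [norm_mul, norm_eR, norm_eR, one_mul]⟩ w (ptSmall D z)
    have h1 := h0.comp_injective embed32_injective
    refine h1.congr fun v ↦ ?_
    have hdiv : (64 * v 1 / 64 : ℤ) = v 1 := Int.mul_ediv_cancel_left _ (by norm_num)
    simp only [Function.comp_apply, latSharp32_embed32, embed32_zero, embed32_one, embed32_two, hdiv]
  have hrk : ∀ (r : Fin 3 → ZMod N) (k : Fin 3 → ℤ),
      (kohnenWt D (liftZ r) : ℂ) * eR (a * discK (liftZ r) / (c * D : ℕ)) *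
        eR (((-(liftZ r 0) * k 2 + liftZ r 1 * k 1 - liftZ r 2 * k 0 : ℤ) : ℝ) / (c * D : ℕ)) =
      wDK D r * ZMod.stdAddChar ((a : ZMod (c * D)) * nZK r + ellZ r k) := by
    intro r k
    rw [mul_assoc, ← eR_add, kohnenWt_eq_wDK hDN (liftZ r)]
    have hl : ∀ i, (((liftZ r i : ℤ)) : ZMod (c * D)) = r i := fun i ↦ by
      rw [liftZ, Int.cast_natCast, ZMod.natCast_zmod_val]
    congr 1
    · congr 1; funext i; exact hl i
    · rw [show (a : ℝ) * (discK (liftZ r) : ℝ) / (c * D : ℕ) +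
          ((-(liftZ r 0) * k 2 + liftZ r 1 * k 1 - liftZ r 2 * k 0 : ℤ) : ℝ) / (c * D : ℕ) =
          ((a * discK (liftZ r) + (-(liftZ r 0) * k 2 + liftZ r 1 * k 1 - liftZ r 2 * k 0) : ℤ) : ℝ) /
            (c * D : ℕ) by push_cast; ring, eR_div_eq_stdAddChar]
      congr 1
      unfold discK nZK ellZ
      push_cast
      rw [hl 0, hl 1, hl 2]
      ring
  set C : ℂ := (((32 * ((c * D : ℕ) : ℝ) ^ 3)⁻¹ : ℝ) : ℂ) * kappa Z' *
    (((64 * (c * D : ℕ) : ℝ) : ℂ))⁻¹ with hCdef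
  set A : (Fin 3 → ZMod N) → (Fin 3 → ℤ) → ℂ := fun r k ↦
    eR (((-(liftZ r 0) * k 2 + liftZ r 1 * k 1 - liftZ r 2 * k 0 : ℤ) : ℝ) / (c * D : ℕ)) *
      eR (d * disc (latFun32 k) / (16384 * (c * D : ℕ))) * shintaniFn w (ptSmall D z) (latFun32 k) with hAdef
  set ω : (Fin 3 → ZMod N) → ℂ := fun r ↦ (kohnenWt D (liftZ r) : ℂ) * eR (a * discK (liftZ r) / (c * D : ℕ))
    with hωdef
  show ∑ r : Fin 3 → ZMod N, ω r * (C * ∑' k, A r k) = C * ∑' k, gaussCoefK D a d c k *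
    shintaniFn w (ptSmall D z) (latFun32 k)
  calc ∑ r : Fin 3 → ZMod N, ω r * (C * ∑' k, A r k)
      = C * ∑ r : Fin 3 → ZMod N, ∑' k, ω r * A r k := by
        rw [Finset.mul_sum]
        refine Finset.sum_congr rfl fun r _ ↦ ?_
        rw [tsum_mul_left]; ring
    _ = C * ∑' k, ∑ r : Fin 3 → ZMod N, ω r * A r k := by
        rw [Summable.tsum_finsetSum (fun r _ ↦ (hk_summ r).mul_left (ω r))]
    _ = C * ∑' k, gaussCoefK D a d c k * shintaniFn w (ptSmall D z) (latFun32 k) := by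
        congr 1
        refine tsum_congr fun k ↦ ?_
        rw [gaussCoefK, Finset.mul_sum, Finset.sum_mul]
        refine Finset.sum_congr rfl fun r _ ↦ ?_
        rw [hωdef, hAdef]
        dsimp only
        rw [← hrk r k]
        ring

end Pieces

/-! ### Evaluation at `c = 128`: the kernel reproduces itself -/

section Eval128

variable (D : ℕ) [NeZero D]

/-- The support map `k ↦ (128k₀, 2k₁, 128k₂)` of the Gauss coefficients at `c = 128`. [folklore] -/
def dblK (k : Fin 3 → ℤ) : Fin 3 → ℤ := ![128 * k 0, 2 * k 1, 128 * k 2]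

omit [NeZero D] in
/-- `dblK_zero` (auxiliary). [folklore] -/
@[simp] theorem dblK_zero (k : Fin 3 → ℤ) : dblK k 0 = 128 * k 0 := rfl
omit [NeZero D] in
/-- `dblK_one` (auxiliary). [folklore] -/
@[simp] theorem dblK_one (k : Fin 3 → ℤ) : dblK k 1 = 2 * k 1 := rfl
omit [NeZero D] in
/-- `dblK_two` (auxiliary). [folklore] -/
@[simp] theorem dblK_two (k : Fin 3 → ℤ) : dblK k 2 = 128 * k 2 := rfl

omit [NeZero D] in
/-- `dblK` is injective. [folklore] -/
theorem dblK_injective : Function.Injective dblK := by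
  intro k l h
  funext i
  fin_cases i
  · have := congrFun h 0; simp [dblK] at this; exact this
  · have := congrFun h 1; simp [dblK] at this; exact this
  · have := congrFun h 2; simp [dblK] at this; exact this

omit [NeZero D] in
/-- `ι₃₂(dblK k) = 128 · ι♮₃₂(k)`. [folklore] -/
theorem latFun32_dblK (k : Fin 3 → ℤ) : latFun32 (dblK k) = (128 : ℝ) • latSharp32 k := by
  ext i
  fin_cases i <;> simp [latFun32, latSharp32, dblK] <;> ring

omit [NeZero D] in
/-- `ℓ(r, dblK k) = B(r, k mod M)`. [folklore] -/
theorem ellZ_dblK {M : ℕ} (r : Fin 3 → ZMod M) (k : Fin 3 → ℤ) :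
    ellZ r (dblK k) = bZK r (fun i ↦ (k i : ZMod M)) := by
  simp only [ellZ, bZK, dblK_zero, dblK_one, dblK_two]
  push_cast
  ring

/-- Off the support the Gauss coefficient vanishes (`c = 128`). [folklore] -/
theorem gaussCoefK_eq_zero_of_not (a d : ℤ) {v : Fin 3 → ℤ}
    (hv : ¬ ((128 : ℤ) ∣ v 0 ∧ (2 : ℤ) ∣ v 1 ∧ (128 : ℤ) ∣ v 2)) :
    gaussCoefK D a d 128 v = 0 := by
  unfold gaussCoefK
  rw [show ((a : ℤ) : ZMod (128 * D)) = (a : ZMod (128 * D)) from rfl]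
  by_cases h0 : (128 : ℤ) ∣ v 0
  · by_cases h1 : (2 : ℤ) ∣ v 1
    · have h2 : ¬ (128 : ℤ) ∣ v 2 := fun h2 ↦ hv ⟨h0, h1, h2⟩
      rw [sum_wDK_mul_stdAddChar_eq_zero_of_two (a : ZMod (128 * D)) v h2, mul_zero]
    · rw [sum_wDK_mul_stdAddChar_eq_zero_of_one (a : ZMod (128 * D)) v h1, mul_zero]
  · rw [sum_wDK_mul_stdAddChar_eq_zero_of_zero (a : ZMod (128 * D)) v h0, mul_zero]

omit [NeZero D] in
/-- The support is the range of `dblK`. [folklore] -/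
theorem exists_dblK_of_dvd {v : Fin 3 → ℤ} (hv : (128 : ℤ) ∣ v 0 ∧ (2 : ℤ) ∣ v 1 ∧ (128 : ℤ) ∣ v 2) :
    ∃ k, dblK k = v := by
  obtain ⟨⟨k0, hk0⟩, ⟨k1, hk1⟩, ⟨k2, hk2⟩⟩ := hv
  exact ⟨![k0, k1, k2], by funext i; fin_cases i <;> simp [dblK, hk0, hk1, hk2]⟩

/-- The constant of the `c = 128` evaluation: `𝒦(a, a*) = (-a*/D) · 128N · G(a; N)`, `N = 128D`. [folklore] -/
def evalConstK (a a' : ℤ) : ℂ :=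
  jacobiSym (-a') D * (128 * (128 * D : ℕ)) *
    Literature.NumberTheory.EllipticCurves.ModularForms.quadGaussSum (128 * D) (a : ZMod (128 * D)) 0

/-- **On the support the Gauss coefficient reproduces the weight** (`c = 128`, `D` odd square-free,
`aa* ≡ 1 (mod 128D)`, `d ≡ a* (mod 128)`): `𝔊_σ(dblK k) = 𝒦(a,a*) χ_{D*}(Q_k)`. [folklore] -/
theorem gaussCoefK_dblK (hsq : Squarefree D) (hodd : Odd D) (a a' d : ℤ)
    (haa' : (a : ZMod (128 * D)) * (a' : ZMod (128 * D)) = 1) (hda : (128 : ℤ) ∣ d - a') (k : Fin 3 → ℤ) :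
    gaussCoefK D a d 128 (dblK k) = evalConstK D a a' * kohnenWt D k := by
  have hDN : D ∣ 128 * D := dvd_mul_left D 128
  unfold gaussCoefK
  simp_rw [ellZ_dblK]
  rw [sum_wDK_mul_stdAddChar_bZK hsq hodd (a : ZMod (128 * D)) (a' : ZMod (128 * D)) haa'
    (fun i ↦ (k i : ZMod (128 * D)))]
  have hw : wDK D (-((a' : ZMod (128 * D)) • fun i ↦ (k i : ZMod (128 * D)))) =
      jacobiSym (-a') D * kohnenWt D k := by
    have e : (-((a' : ZMod (128 * D)) • fun i ↦ (k i : ZMod (128 * D)))) =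
        fun i ↦ ((((-a') • k) i : ℤ) : ZMod (128 * D)) := by
      funext i; simp [Pi.smul_apply, smul_eq_mul]
    rw [e, ← kohnenWt_eq_wDK hDN, kohnenWt_smul hsq]
    push_cast
    ring
  rw [hw, latFun32_dblK, disc_smul, disc_latSharp32_eq_discK]
  by_cases hv : kohnenWt D k = 0
  · simp [hv]
  · have hDn : (D : ℤ) ∣ discK k := by
      by_contra h; exact hv (kohnenWt_of_not_dvd hsq h)
    have hphase : eR (d * ((128 : ℝ) ^ 2 * (discK k : ℝ)) / (16384 * (128 * D : ℕ))) *
        (ZMod.stdAddChar (-((a' : ZMod (128 * D)) * nZK fun i ↦ (k i : ZMod (128 * D)))) : ℂ) = 1 := by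
      have e1 : (d : ℝ) * ((128 : ℝ) ^ 2 * (discK k : ℝ)) / (16384 * (128 * D : ℕ)) =
          ((d * discK k : ℤ) : ℝ) / (128 * D : ℕ) := by
        have : ((128 * D : ℕ) : ℝ) ≠ 0 := by exact_mod_cast NeZero.ne (128 * D)
        push_cast; field_simp; ring
      have e2 : (nZK fun i ↦ (k i : ZMod (128 * D))) = ((discK k : ℤ) : ZMod (128 * D)) := by
        unfold nZK discK; push_cast; ring
      rw [e1, eR_div_eq_stdAddChar, e2, ← AddChar.map_add_eq_mul]
      have : ((d * discK k : ℤ) : ZMod (128 * D)) + -((a' : ZMod (128 * D)) * ((discK k : ℤ) : ZMod (128 * D))) = 0 := by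
        obtain ⟨m, hm⟩ := hDn
        obtain ⟨e, he⟩ := hda
        have : (d * discK k - a' * discK k : ℤ) = (128 * D : ℕ) * (e * m) := by
          rw [← sub_mul, he, hm]; push_cast; ring
        have h0 : ((d * discK k - a' * discK k : ℤ) : ZMod (128 * D)) = 0 := by
          rw [this, Int.cast_mul, Int.cast_natCast, ZMod.natCast_self, zero_mul]
        push_cast at h0 ⊢
        linear_combination h0
      rw [this, AddChar.map_zero_eq_one]
    unfold evalConstK
    linear_combination (jacobiSym (-a') D * kohnenWt D k * (128 * (128 * D : ℕ)) *
      Literature.NumberTheory.EllipticCurves.ModularForms.quadGaussSum (128 * D)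
        (a : ZMod (128 * D)) 0 : ℂ) * hphase

/-- A series of Gauss coefficients against `ι₃₂` collapses to the weight series against `128 ι♮₃₂`.
[folklore] -/
theorem tsum_gaussCoefK_mul (hsq : Squarefree D) (hodd : Odd D) (a a' d : ℤ)
    (haa' : (a : ZMod (128 * D)) * (a' : ZMod (128 * D)) = 1) (hda : (128 : ℤ) ∣ d - a')
    (F : V → ℂ) :
    ∑' v : Fin 3 → ℤ, gaussCoefK D a d 128 v * F (latFun32 v) =
      evalConstK D a a' * ∑' k : Fin 3 → ℤ, (kohnenWt D k : ℂ) * F ((128 : ℝ) • latSharp32 k) := by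
  have hsupp : Function.support (fun v : Fin 3 → ℤ ↦ gaussCoefK D a d 128 v * F (latFun32 v)) ⊆
      Set.range dblK := by
    intro v hv
    rw [Function.mem_support] at hv
    by_cases h : (128 : ℤ) ∣ v 0 ∧ (2 : ℤ) ∣ v 1 ∧ (128 : ℤ) ∣ v 2
    · obtain ⟨k, hk⟩ := exists_dblK_of_dvd h
      exact ⟨k, hk⟩
    · exact absurd (by rw [gaussCoefK_eq_zero_of_not D a d h, zero_mul]) hv
  rw [← tsum_subtype_eq_of_support_subset hsupp,
    ← (Equiv.ofInjective dblK dblK_injective).tsum_eq, ← tsum_mul_left]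
  refine tsum_congr fun k ↦ ?_
  simp only [Equiv.ofInjective_apply]
  rw [gaussCoefK_dblK D hsq hodd a a' d haa' hda, latFun32_dblK]
  ring

/-- `f_{w, z/(16384D)}(128 x) = 128 f_{w, z/D}(x)`. [folklore] -/
theorem shintaniFn_ptSmall_128 (w z : ℍ) (x : V) :
    shintaniFn w (ptSmall D z) ((128 : ℝ) • x) = 128 * shintaniFn w (ptK D z) x := by
  rw [shintaniFn_smul w (ptSmall D z) (by norm_num : (0 : ℝ) < 128) x]
  push_cast
  congr 2
  rw [ptSmall, mulPos_mulPos]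
  apply UpperHalfPlane.ext
  simp only [coe_mulPos]
  have hD : (D : ℂ) ≠ 0 := by exact_mod_cast NeZero.ne D
  push_cast
  field_simp
  ring

/-- **The kernel reproduces itself under `σ = (a b; 128 d)`** (`D` odd square-free, `aa* ≡ 1 (mod 128D)`):
`𝒦_D(w, σz) = (Im σz)^{1/2} (32N³)⁻¹ κ(Z') (64N)⁻¹ · 128 𝒦(a,a*) · (Im z)^{-1/2} 𝒦_D(w, z)`. [folklore] -/
theorem kerK_smul_sigma (hsq : Squarefree D) (hodd : Odd D) (σ : SL(2, ℤ)) (hc : (σ 1 0 : ℤ) = 128)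
    (a' : ℤ) (haa' : ((σ 0 0 : ℤ) : ZMod (128 * D)) * (a' : ZMod (128 * D)) = 1) (w z : ℍ) :
    kerK D w (σ • z) = (Real.sqrt (σ • z).im : ℂ) *
      ((((32 * ((128 * D : ℕ) : ℝ) ^ 3)⁻¹ : ℝ) : ℂ) * kappa (invFour (auxWK (128 * D) 128 (σ 1 1) z)) *
        (((64 * (128 * D : ℕ) : ℝ) : ℂ))⁻¹) *
      (128 * evalConstK D (σ 0 0) a' * ((Real.sqrt z.im : ℂ))⁻¹ * kerK D w z) := by
  have hda : (128 : ℤ) ∣ (σ 1 1 : ℤ) - a' := by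
    have hdet := Literature.NumberTheory.EllipticCurves.ModularForms.det_eq_one' σ
    rw [hc] at hdet
    have h1 : ((σ 0 0 : ℤ) : ZMod 128) * ((σ 1 1 : ℤ) : ZMod 128) = 1 := by
      have := congrArg (fun x : ℤ ↦ (x : ZMod 128)) hdet
      push_cast at this
      have h128 : (128 : ZMod 128) = 0 := by decide
      rw [h128, mul_zero, sub_zero] at this
      exact this
    have h2 : ((σ 0 0 : ℤ) : ZMod 128) * ((a' : ℤ) : ZMod 128) = 1 := by
      have := congrArg (ZMod.castHom (dvd_mul_right 128 D) (ZMod 128)) haa'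
      rw [map_mul, map_one, map_intCast, map_intCast] at this
      exact this
    have hu : IsUnit ((σ 0 0 : ℤ) : ZMod 128) := IsUnit.of_mul_eq_one _ h1
    have h3 : ((σ 1 1 : ℤ) : ZMod 128) = ((a' : ℤ) : ZMod 128) := hu.mul_left_cancel (h1.trans h2.symm)
    have h4 : (((σ 1 1 : ℤ) - a' : ℤ) : ZMod 128) = 0 := by
      push_cast
      rw [h3, sub_self]
    exact_mod_cast (ZMod.intCast_zmod_eq_zero_iff_dvd _ 128).mp h4
  haveI : NeZero (128 : ℕ) := ⟨by norm_num⟩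
  rw [kerK_smul D σ 128 hc w z]
  congr 1
  rw [tsum_gaussCoefK_mul D hsq hodd (σ 0 0) a' (σ 1 1) haa' hda _]
  simp_rw [shintaniFn_ptSmall_128]
  rw [kerK_eq_tsum]
  have hz : (Real.sqrt z.im : ℂ) ≠ 0 := by
    exact_mod_cast (Real.sqrt_pos.mpr z.im_pos).ne'
  rw [show ∑' k : Fin 3 → ℤ, (kohnenWt D k : ℂ) * (128 * shintaniFn w (ptK D z) (latSharp32 k)) =
      128 * ∑' k : Fin 3 → ℤ, (kohnenWt D k : ℂ) * shintaniFn w (ptK D z) (latSharp32 k) by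
    rw [← tsum_mul_left]; exact tsum_congr fun k ↦ by ring]
  field_simp

end Eval128

/-! ### The constants at `σ = (a b; 128 d)` and the constant identity -/

section Constants

variable (D : ℕ) [NeZero D]

/-- `r = N |w₁|²`, `N = 128 D`, `w₁ = 128 z + d`. [folklore] -/
def rZK (d : ℤ) (z : ℍ) : ℝ := (128 * D : ℕ) * Complex.normSq (w128 d z)

/-- `r > 0`. [folklore] -/
theorem rZK_pos (d : ℤ) (z : ℍ) : 0 < rZK D d z := by
  unfold rZK
  have h1 : (0 : ℝ) < (128 * D : ℕ) := by exact_mod_cast Nat.pos_of_ne_zero (NeZero.ne _)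
  have h2 := Complex.normSq_pos.mpr (w128_ne_zero d z)
  positivity

/-- The point `Z' = -1/(N w₁)`. [folklore] -/
theorem coe_Z'K (d : ℤ) (z : ℍ) :
    ((invFour (auxWK (128 * D) 128 d z) : ℍ) : ℂ) = -1 / ((128 * D : ℕ) * w128 d z) := by
  haveI : NeZero (128 : ℕ) := ⟨by norm_num⟩
  rw [coe_invFour_auxWK, w128]; push_cast; ring

/-- `a_S(Z') = (4/r)(-i w₁)`. [folklore] -/
theorem aS_Z'K (d : ℤ) (z : ℍ) :
    aS (invFour (auxWK (128 * D) 128 d z)) = ((4 / rZK D d z : ℝ) : ℂ) * (-I * w128 d z) := by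
  have hw0 := w128_ne_zero d z
  have hcw0 : conj (w128 d z) ≠ 0 := (map_ne_zero _).mpr hw0
  have hN0 : ((128 * D : ℕ) : ℂ) ≠ 0 := by exact_mod_cast NeZero.ne (128 * D)
  have hnsq : ((Complex.normSq (w128 d z) : ℝ) : ℂ) = w128 d z * conj (w128 d z) :=
    (Complex.mul_conj (w128 d z)).symm
  have hconj : conj (-1 / (((128 * D : ℕ) : ℂ) * w128 d z)) =
      -1 / (((128 * D : ℕ) : ℂ) * conj (w128 d z)) := by
    rw [map_div₀, map_mul, map_neg, map_one, map_natCast]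
  rw [aS, coe_Z'K, hconj, rZK]
  push_cast
  rw [hnsq]
  field_simp

/-- `a_B(Z') = (2/r)(i w̄₁)`. [folklore] -/
theorem aB_Z'K (d : ℤ) (z : ℍ) :
    aB (invFour (auxWK (128 * D) 128 d z)) = ((2 / rZK D d z : ℝ) : ℂ) * (I * conj (w128 d z)) := by
  have hw0 := w128_ne_zero d z
  have hcw0 : conj (w128 d z) ≠ 0 := (map_ne_zero _).mpr hw0
  have hN0 : ((128 * D : ℕ) : ℂ) ≠ 0 := by exact_mod_cast NeZero.ne (128 * D)
  have hnsq : ((Complex.normSq (w128 d z) : ℝ) : ℂ) = w128 d z * conj (w128 d z) :=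
    (Complex.mul_conj (w128 d z)).symm
  rw [aB, coe_Z'K, rZK]
  push_cast
  rw [hnsq]
  field_simp

/-- `a_T(Z') = (4/r)(i w̄₁)`. [folklore] -/
theorem aT_Z'K (d : ℤ) (z : ℍ) :
    aT (invFour (auxWK (128 * D) 128 d z)) = ((4 / rZK D d z : ℝ) : ℂ) * (I * conj (w128 d z)) := by
  have hw0 := w128_ne_zero d z
  have hcw0 : conj (w128 d z) ≠ 0 := (map_ne_zero _).mpr hw0
  have hN0 : ((128 * D : ℕ) : ℂ) ≠ 0 := by exact_mod_cast NeZero.ne (128 * D)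
  have hnsq : ((Complex.normSq (w128 d z) : ℝ) : ℂ) = w128 d z * conj (w128 d z) :=
    (Complex.mul_conj (w128 d z)).symm
  rw [aT, coe_Z'K, rZK]
  push_cast
  rw [hnsq]
  field_simp

/-- `1/(2Z') = -N w₁/2`. [folklore] -/
theorem one_div_two_Z'K (d : ℤ) (z : ℍ) :
    1 / (2 * ((invFour (auxWK (128 * D) 128 d z) : ℍ) : ℂ)) = -((128 * D : ℕ) * w128 d z) / 2 := by
  have hw0 := w128_ne_zero d z
  have hN0 : ((128 * D : ℕ) : ℂ) ≠ 0 := by exact_mod_cast NeZero.ne (128 * D)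
  rw [coe_Z'K]
  field_simp

/-- **`κ(Z')`**: `κ(Z') · 8√2 β = -N² √N w₁ |w₁|²`, `N = 128 D`. [folklore] -/
theorem kappa_Z'K_mul (d : ℤ) (z : ℍ) :
    kappa (invFour (auxWK (128 * D) 128 d z)) *
        (8 * (Real.sqrt 2 : ℂ) * (I * conj (w128 d z)) ^ (1 / 2 : ℂ)) =
      -((((128 * D : ℕ) : ℝ) : ℂ)) ^ 2 * (Real.sqrt ((128 * D : ℕ)) : ℂ) * w128 d z *
        (Complex.normSq (w128 d z) : ℂ) := by
  have hr := rZK_pos D d z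
  set ρ : ℝ := Real.sqrt (Complex.normSq (w128 d z)) with hρ
  set sM : ℝ := Real.sqrt ((128 * D : ℕ)) with hsM
  have hρ0 : 0 < ρ := Real.sqrt_pos.mpr (Complex.normSq_pos.mpr (w128_ne_zero d z))
  have hM0 : (0 : ℝ) < (128 * D : ℕ) := by exact_mod_cast Nat.pos_of_ne_zero (NeZero.ne _)
  have hsM0 : 0 < sM := Real.sqrt_pos.mpr hM0
  have hsr : Real.sqrt (rZK D d z) = sM * ρ := by
    rw [rZK]; exact Real.sqrt_mul hM0.le _
  have hs4 : Real.sqrt 4 = 2 := by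
    rw [show (4 : ℝ) = 2 ^ 2 by norm_num]; exact Real.sqrt_sq (by norm_num)
  have h4 : Real.sqrt (4 / rZK D d z) = 2 / (sM * ρ) := by
    rw [Real.sqrt_div' _ hr.le, hs4, hsr]
  have h2 : Real.sqrt (2 / rZK D d z) = Real.sqrt 2 / (sM * ρ) := by
    rw [Real.sqrt_div' _ hr.le, hsr]
  have hαβ := cpow_half_mul_cpow_half_conj (im_w128_pos d z)
  have hβ := beta128_ne_zero d z
  set β : ℂ := (I * conj (w128 d z)) ^ (1 / 2 : ℂ) with hβdef
  set α : ℂ := (-I * w128 d z) ^ (1 / 2 : ℂ) with hαdef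
  have hα : α = (ρ : ℂ) / β := by rw [eq_div_iff hβ]; exact hαβ
  have hs2 : (Real.sqrt 2 : ℂ) ≠ 0 := by
    exact_mod_cast (Real.sqrt_pos.mpr (by norm_num : (0:ℝ) < 2)).ne'
  have hnsq : ((Complex.normSq (w128 d z) : ℝ) : ℂ) = (ρ : ℂ) ^ 2 := by
    rw [hρ]; exact_mod_cast (Real.sq_sqrt (Complex.normSq_nonneg _)).symm
  have hρ0' : (ρ : ℂ) ≠ 0 := by exact_mod_cast hρ0.ne'
  have hsM0' : (sM : ℂ) ≠ 0 := by exact_mod_cast hsM0.ne'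
  have hsMsq : ((sM : ℂ)) ^ 2 = 128 * (D : ℂ) := by
    rw [hsM]
    have := Real.sq_sqrt hM0.le
    push_cast at this ⊢
    exact_mod_cast this
  unfold kappa
  rw [one_div_two_Z'K, aS_Z'K, aB_Z'K, aT_Z'K, cpow_half_ofReal_mul (by positivity),
    cpow_half_ofReal_mul (by positivity), cpow_half_ofReal_mul (by positivity), h4, h2,
    ← hαdef, ← hβdef, hα, hnsq]
  push_cast
  field_simp
  linear_combination (-(8 : ℂ) * D * w128 d z) * hsMsq

end Constants

/-! ### The arithmetic identity and the constant identity -/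

section Arith

variable (D : ℕ) [NeZero D]

omit [NeZero D] in
/-- `(-a*/D)(128a/D) = (-2/D)` for `a a* ≡ 1 (mod D)`, `D` odd (`(64/D) = 1`). [folklore] -/
theorem jacobi_prodK (hodd : Odd D) {a a' : ℤ} (hDm : ((a * a' : ℤ) : ZMod D) = 1) :
    (jacobiSym (-a') D : ℤ) * jacobiSym (128 * a) D = jacobiSym (-2) D := by
  rw [← jacobiSym.mul_left]
  have hmod : (-a' * (128 * a) : ℤ) ≡ -2 * 8 ^ 2 [ZMOD D] := by
    have h1 : (a * a' : ℤ) ≡ 1 [ZMOD D] := by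
      rw [← ZMod.intCast_eq_intCast_iff]
      push_cast at hDm ⊢
      exact hDm
    have := h1.mul_left (-128)
    rw [show (-128) * (a * a') = -a' * (128 * a) by ring] at this
    have e : (-2 : ℤ) * 8 ^ 2 = -128 * 1 := by norm_num
    rw [e]
    exact this
  rw [jacobiSym.mod_left' hmod, jacobiSym.mul_left]
  have h8 : (8 : ℤ).gcd D = 1 := by
    have h2 : Nat.Coprime 2 D := Nat.coprime_two_left.mpr hodd
    have : Nat.Coprime 8 D := by simpa using Nat.Coprime.pow_left 3 h2
    exact_mod_cast this
  rw [jacobiSym.sq_one' h8, mul_one]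

/-- **The `z`-free identity** behind the level-`128` law of `𝒦_D` (`D ≡ 3 (mod 4)` square-free,
`gcd(a, D) = 1`, `a` odd, `a a* ≡ 1 (mod D)`): `256 √D · 𝒦(a, a*) = i · N² · G(a; 128)³`, `N = 128D`.
[folklore] -/
theorem evalConstK_key (hD3 : D % 4 = 3) {a a' : ℤ} (haD : a.gcd D = 1) (ha : Odd a)
    (hDm : ((a * a' : ℤ) : ZMod D) = 1) :
    256 * (Real.sqrt D : ℂ) * evalConstK D a a' =
      I * ((128 * D : ℕ) : ℂ) ^ 2 * quadGaussSum 128 a 0 ^ 3 := by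
  have hodd : Odd D := Nat.odd_iff.mpr (by omega)
  have hcop : Nat.Coprime 128 D := coprime_128_of_odd hodd
  have hs2sq : ((Real.sqrt 2 : ℂ)) ^ 2 = 2 := by exact_mod_cast Real.sq_sqrt (by norm_num : (0:ℝ) ≤ 2)
  have hD0 : (0 : ℝ) < D := by exact_mod_cast Nat.pos_of_ne_zero (NeZero.ne D)
  have hsDsq : ((Real.sqrt D : ℂ)) ^ 2 = D := by exact_mod_cast Real.sq_sqrt hD0.le
  have I_sq : I ^ 2 = -1 := Complex.I_sq
  have he8 : (((ZMod.χ₈ (a : ZMod 8)) : ℤ) : ℂ) ^ 2 = 1 := χ₈_sq_of_odd ha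
  -- the Gauss sum modulo `N = 128 D`
  have hDa : Odd ((D : ℤ) * a) := (by exact_mod_cast hodd : Odd (D : ℤ)).mul ha
  have hgcd : (((128 : ℕ) : ℤ) * a).gcd D = 1 := by
    have h1 : IsCoprime (a : ℤ) (D : ℤ) := Int.isCoprime_iff_gcd_eq_one.mpr haD
    have h2 : IsCoprime ((128 : ℕ) : ℤ) (D : ℤ) := by
      rw [Int.isCoprime_iff_gcd_eq_one]; exact_mod_cast hcop
    exact Int.isCoprime_iff_gcd_eq_one.mp (h2.mul_left h1)
  have hG : quadGaussSum (128 * D) (a : ZMod (128 * D)) 0 =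
      (8 * (Real.sqrt 2 : ℂ) * ZMod.χ₈ (((D : ℤ) * a : ℤ) : ZMod 8) *
        (1 + (ZMod.stdAddChar ((((D : ℤ) * a : ℤ)) : ZMod 4) : ℂ))) *
      (jacobiSym (((128 : ℕ) : ℤ) * a) D * quadGaussSum D 1 0) := by
    have h := quadGaussSum_mul_of_coprime hcop a
    rw [h, quadGaussSum_128_of_odd hDa, quadGaussSum_eq_jacobiSym_mul hodd hgcd]
  have hG1 : quadGaussSum D 1 0 = I * Real.sqrt D := quadGaussSum_one_of_mod_four_eq_three hD3
  have hJJ0 := jacobi_prodK D hodd hDm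
  rw [jacobiSym.at_neg_two hodd] at hJJ0
  -- `D mod 8 ∈ {3, 7}` and `a mod 4 ∈ {1, 3}`
  have hD8 : D % 8 = 3 ∨ D % 8 = 7 := by omega
  have hD4 : ((D : ℕ) : ZMod 4) = 3 := by
    rw [← ZMod.natCast_mod D 4, hD3]; rfl
  have ha4 : (a : ZMod 4) = 1 ∨ (a : ZMod 4) = 3 := by
    have h2 : a % 2 = 1 := Int.odd_iff.mp ha
    have : a % 4 = 1 ∨ a % 4 = 3 := by omega
    rcases this with h | h
    · left; rw [← ZMod.intCast_mod a 4, show a % ((4 : ℕ) : ℤ) = 1 by exact_mod_cast h]; rfl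
    · right; rw [← ZMod.intCast_mod a 4, show a % ((4 : ℕ) : ℤ) = 3 by exact_mod_cast h]; rfl
  have hχDa : ((ZMod.χ₈ (((D : ℤ) * a : ℤ) : ZMod 8) : ℤ) : ℂ) =
      ((ZMod.χ₈ ((D : ℕ) : ZMod 8) : ℤ) : ℂ) * ((ZMod.χ₈ (a : ZMod 8) : ℤ) : ℂ) := by
    push_cast
    rw [map_mul, Int.cast_mul]
  have hψDa : ((((D : ℤ) * a : ℤ)) : ZMod 4) = 3 * (a : ZMod 4) := by push_cast; rw [hD4]
  unfold evalConstK
  rw [hG, hG1, hχDa, hψDa]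
  set e8 : ℂ := ((ZMod.χ₈ (a : ZMod 8) : ℤ) : ℂ) with he8def
  set J1 : ℂ := ((jacobiSym (-a') D : ℤ) : ℂ) with hJ1
  set J2 : ℂ := ((jacobiSym (((128 : ℕ) : ℤ) * a) D : ℤ) : ℂ) with hJ2
  have hJJ : J1 * J2 = ((ZMod.χ₈' (D : ℕ) : ℤ) : ℂ) := by
    rw [hJ1, hJ2]; exact_mod_cast hJJ0
  rw [quadGaussSum_128_of_odd ha]
  rcases hD8 with h83 | h87
  · have hD8c : ((D : ℕ) : ZMod 8) = 3 := by rw [← ZMod.natCast_mod D 8, h83]; rfl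
    rw [hD8c, show ZMod.χ₈ (3 : ZMod 8) = -1 by decide]
    rw [hD8c, show ZMod.χ₈' (3 : ZMod 8) = 1 by decide] at hJJ
    rcases ha4 with h1 | h3
    · rw [h1, show (3 * 1 : ZMod 4) = 3 by decide, stdAddChar_four_three, stdAddChar_four_one]
      push_cast at hJJ ⊢
      linear_combination
        (33554432 * (D : ℂ) * (Real.sqrt 2 : ℂ) * (-1) * e8 * (1 + (-I)) * I * (Real.sqrt D : ℂ) ^ 2) * hJJ +
        (33554432 * (D : ℂ) * (Real.sqrt 2 : ℂ) * (-1) * e8 * (1 + (-I)) * I * 1) * hsDsq +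
        (-(8388608 : ℂ) * I * (D : ℂ) ^ 2 * (Real.sqrt 2 : ℂ) ^ 3 * e8 * (1 + I) ^ 3) * he8 +
        (-(8388608 : ℂ) * I * (D : ℂ) ^ 2 * e8 * (1 + I) ^ 3 * (Real.sqrt 2 : ℂ)) * hs2sq +
        (-(16777216 : ℂ) * I * (D : ℂ) ^ 2 * (Real.sqrt 2 : ℂ) * e8 * (3 + 1 * I)) * I_sq
    · rw [h3, show (3 * 3 : ZMod 4) = 1 by decide, stdAddChar_four_three, stdAddChar_four_one]
      push_cast at hJJ ⊢
      linear_combination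
        (33554432 * (D : ℂ) * (Real.sqrt 2 : ℂ) * (-1) * e8 * (1 + I) * I * (Real.sqrt D : ℂ) ^ 2) * hJJ +
        (33554432 * (D : ℂ) * (Real.sqrt 2 : ℂ) * (-1) * e8 * (1 + I) * I * 1) * hsDsq +
        (-(8388608 : ℂ) * I * (D : ℂ) ^ 2 * (Real.sqrt 2 : ℂ) ^ 3 * e8 * (1 + (-I)) ^ 3) * he8 +
        (-(8388608 : ℂ) * I * (D : ℂ) ^ 2 * e8 * (1 + (-I)) ^ 3 * (Real.sqrt 2 : ℂ)) * hs2sq +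
        (-(16777216 : ℂ) * I * (D : ℂ) ^ 2 * (Real.sqrt 2 : ℂ) * e8 * (3 + (-1) * I)) * I_sq
  · have hD8c : ((D : ℕ) : ZMod 8) = 7 := by rw [← ZMod.natCast_mod D 8, h87]; rfl
    rw [hD8c, show ZMod.χ₈ (7 : ZMod 8) = 1 by decide]
    rw [hD8c, show ZMod.χ₈' (7 : ZMod 8) = -1 by decide] at hJJ
    rcases ha4 with h1 | h3
    · rw [h1, show (3 * 1 : ZMod 4) = 3 by decide, stdAddChar_four_three, stdAddChar_four_one]
      push_cast at hJJ ⊢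
      linear_combination
        (33554432 * (D : ℂ) * (Real.sqrt 2 : ℂ) * 1 * e8 * (1 + (-I)) * I * (Real.sqrt D : ℂ) ^ 2) * hJJ +
        (33554432 * (D : ℂ) * (Real.sqrt 2 : ℂ) * 1 * e8 * (1 + (-I)) * I * (-1)) * hsDsq +
        (-(8388608 : ℂ) * I * (D : ℂ) ^ 2 * (Real.sqrt 2 : ℂ) ^ 3 * e8 * (1 + I) ^ 3) * he8 +
        (-(8388608 : ℂ) * I * (D : ℂ) ^ 2 * e8 * (1 + I) ^ 3 * (Real.sqrt 2 : ℂ)) * hs2sq +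
        (-(16777216 : ℂ) * I * (D : ℂ) ^ 2 * (Real.sqrt 2 : ℂ) * e8 * (3 + 1 * I)) * I_sq
    · rw [h3, show (3 * 3 : ZMod 4) = 1 by decide, stdAddChar_four_three, stdAddChar_four_one]
      push_cast at hJJ ⊢
      linear_combination
        (33554432 * (D : ℂ) * (Real.sqrt 2 : ℂ) * 1 * e8 * (1 + I) * I * (Real.sqrt D : ℂ) ^ 2) * hJJ +
        (33554432 * (D : ℂ) * (Real.sqrt 2 : ℂ) * 1 * e8 * (1 + I) * I * (-1)) * hsDsq +
        (-(8388608 : ℂ) * I * (D : ℂ) ^ 2 * (Real.sqrt 2 : ℂ) ^ 3 * e8 * (1 + (-I)) ^ 3) * he8 +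
        (-(8388608 : ℂ) * I * (D : ℂ) ^ 2 * e8 * (1 + (-I)) ^ 3 * (Real.sqrt 2 : ℂ)) * hs2sq +
        (-(16777216 : ℂ) * I * (D : ℂ) ^ 2 * (Real.sqrt 2 : ℂ) * e8 * (3 + (-1) * I)) * I_sq

end Arith

/-! ### The constant identity, the `σ`-law and the assembly on `Γ₀(128)` -/

section Law

variable (D : ℕ) [NeZero D]

/-- **The constant identity at `σ = (a b; 128 d)`** for `𝒦_D` (`D ≡ 3 (mod 4)` square-free,
`gcd(a, D) = 1`, `a a* ≡ 1 (mod D)`): the constant produced by the Poisson step equals the cube of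
the `θ`-multiplier (trivial character). [folklore] -/
theorem const_identityK (hD3 : D % 4 = 3) {a a' d : ℤ} (haD : a.gcd D = 1) (ha : Odd a)
    (hDm : ((a * a' : ℤ) : ZMod D) = 1) (z : ℍ) :
    (Real.sqrt (z.im / Complex.normSq (w128 d z)) : ℂ) *
        ((((32 * ((128 * D : ℕ) : ℝ) ^ 3)⁻¹ : ℝ) : ℂ) * kappa (invFour (auxWK (128 * D) 128 d z)) *
          (((64 * (128 * D : ℕ) : ℝ) : ℂ))⁻¹) *
        (128 * evalConstK D a a' * ((Real.sqrt z.im : ℂ))⁻¹) =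
      (1 / (2 * I * ((128 : ℕ) : ℂ) / (((128 : ℕ) : ℂ) * z + d)) ^ (1 / 2 : ℂ) *
        quadGaussSum 128 a 0) ^ 3 := by
  have hw0 := w128_ne_zero d z
  have hn0 : (0 : ℝ) < Complex.normSq (w128 d z) := Complex.normSq_pos.mpr hw0
  set ρ : ℝ := Real.sqrt (Complex.normSq (w128 d z)) with hρ
  have hρ0 : 0 < ρ := Real.sqrt_pos.mpr hn0
  set β : ℂ := (I * conj (w128 d z)) ^ (1 / 2 : ℂ) with hβdef
  have hβ : β ≠ 0 := beta128_ne_zero d z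
  set sD : ℝ := Real.sqrt D with hsD
  have hD0 : (0 : ℝ) < D := by exact_mod_cast Nat.pos_of_ne_zero (NeZero.ne D)
  have hsD0 : 0 < sD := Real.sqrt_pos.mpr hD0
  set sy : ℝ := Real.sqrt z.im with hsy
  have hsy0 : 0 < sy := Real.sqrt_pos.mpr z.im_pos
  have hs2 : (0 : ℝ) < Real.sqrt 2 := Real.sqrt_pos.mpr (by norm_num)
  have hκ := kappa_Z'K_mul D d z
  have hsM : Real.sqrt ((128 * D : ℕ)) = 8 * Real.sqrt 2 * sD := by
    rw [show (((128 * D : ℕ) : ℝ)) = (8 ^ 2 * 2) * D by push_cast; ring,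
      Real.sqrt_mul (by norm_num), Real.sqrt_mul (by norm_num), Real.sqrt_sq (by norm_num)]
  rw [hsM] at hκ
  have hκ' : kappa (invFour (auxWK (128 * D) 128 d z)) =
      -((((128 * D : ℕ) : ℝ) : ℂ)) ^ 2 * ((8 * Real.sqrt 2 * sD : ℝ) : ℂ) * w128 d z *
        (Complex.normSq (w128 d z) : ℂ) / (8 * (Real.sqrt 2 : ℂ) * β) := by
    rw [eq_div_iff (by
      refine mul_ne_zero (mul_ne_zero (by norm_num) ?_) hβ
      exact_mod_cast hs2.ne')]
    exact hκ
  have him : Real.sqrt (z.im / Complex.normSq (w128 d z)) = sy / ρ := by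
    rw [Real.sqrt_div' _ hn0.le]
  have hnsq : ((Complex.normSq (w128 d z) : ℝ) : ℂ) = (ρ : ℂ) ^ 2 := by
    rw [hρ]; exact_mod_cast (Real.sq_sqrt (Complex.normSq_nonneg _)).symm
  have hR := rho128_sq_eq d z
  rw [← hρ, ← hβdef] at hR
  have key := evalConstK_key D hD3 haD ha hDm
  rw [← hsD] at key
  have hsD0' : (sD : ℂ) ≠ 0 := by exact_mod_cast hsD0.ne'
  have hE : evalConstK D a a' = I * ((128 * D : ℕ) : ℂ) ^ 2 * quadGaussSum 128 a 0 ^ 3 / (256 * sD) := by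
    rw [eq_div_iff (mul_ne_zero (by norm_num) hsD0')]
    linear_combination key
  rw [him, hκ', hE, thetaFactor_sigma128, hnsq, ← hρ, ← hβdef]
  have hρ0' : (ρ : ℂ) ≠ 0 := by exact_mod_cast hρ0.ne'
  have hsy0' : (sy : ℂ) ≠ 0 := by exact_mod_cast hsy0.ne'
  have hs20 : (Real.sqrt 2 : ℂ) ≠ 0 := by exact_mod_cast hs2.ne'
  have hD0' : (D : ℂ) ≠ 0 := by exact_mod_cast hD0.ne'
  push_cast
  field_simp
  linear_combination (-(524288 : ℂ) * quadGaussSum 128 a 0 ^ 3) * hR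

/-- **The `σ`-law**: `𝒦_D(w, σz) θ(z)³ = θ(σz)³ 𝒦_D(w, z)` for `σ = (a b; 128 d)` with `gcd(a, D) = 1`
(`D ≡ 3 (mod 4)` square-free). [cite: Shintani1975, Prop. 1.6] -/
theorem kerK_sigma_law (hsq : Squarefree D) (hD3 : D % 4 = 3) (σ : SL(2, ℤ))
    (hc : (σ 1 0 : ℤ) = 128) (haD : (σ 0 0 : ℤ).gcd D = 1) (w z : ℍ) :
    kerK D w (σ • z) * shimuraTheta z ^ 3 = shimuraTheta (σ • z) ^ 3 * kerK D w z := by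
  have hodd : Odd D := Nat.odd_iff.mpr (by omega)
  have hdet := det_eq_one' σ
  rw [hc] at hdet
  have ha : Odd (σ 0 0 : ℤ) := by
    by_contra h
    rw [Int.not_odd_iff_even] at h
    obtain ⟨k, hk⟩ := h
    rw [hk] at hdet
    have : (2 : ℤ) ∣ 1 := ⟨k * σ 1 1 - σ 0 1 * 64, by linear_combination (-1 : ℤ) * hdet⟩
    omega
  have hcopZ : IsCoprime (σ 0 0 : ℤ) ((128 * D : ℕ) : ℤ) := by
    have h2 : IsCoprime (σ 0 0 : ℤ) 2 := by
      obtain ⟨k, hk⟩ := ha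
      exact ⟨1, -k, by rw [hk]; ring⟩
    have h128 : IsCoprime (σ 0 0 : ℤ) ((2 : ℤ) ^ 7) := h2.pow_right
    have hD : IsCoprime (σ 0 0 : ℤ) (D : ℤ) := Int.isCoprime_iff_gcd_eq_one.mpr haD
    have := h128.mul_right hD
    push_cast
    norm_num at this
    exact this
  have hunit : IsUnit ((σ 0 0 : ℤ) : ZMod (128 * D)) := by
    rw [ZMod.coe_int_isUnit_iff_isCoprime]; exact hcopZ.symm
  obtain ⟨u, hu⟩ := hunit
  set a' : ℤ := (((u⁻¹ : (ZMod (128 * D))ˣ) : ZMod (128 * D)).val : ℤ) with ha'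
  have haa' : ((σ 0 0 : ℤ) : ZMod (128 * D)) * (a' : ZMod (128 * D)) = 1 := by
    rw [ha', Int.cast_natCast, ZMod.natCast_zmod_val, ← hu, Units.mul_inv]
  have hDm : (((σ 0 0 : ℤ) * a' : ℤ) : ZMod D) = 1 := by
    have := congrArg (ZMod.castHom (dvd_mul_left D 128) (ZMod D)) haa'
    rw [map_mul, map_one, map_intCast, map_intCast] at this
    push_cast
    exact this
  haveI : NeZero (128 : ℕ) := ⟨by norm_num⟩
  have hK := kerK_smul_sigma D hsq hodd σ hc a' haa' w z
  have hθ : shimuraTheta (σ • z) =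
      1 / (2 * I * ((128 : ℕ) : ℂ) / (((128 : ℕ) : ℂ) * z + (σ 1 1 : ℤ))) ^ (1 / 2 : ℂ) *
        quadGaussSum 128 (σ 0 0 : ℤ) 0 * shimuraTheta z := by
    rw [← thetaMul_one_eq_shimuraTheta, ← thetaMul_one_eq_shimuraTheta]
    exact thetaMul_one_smul hc (by norm_num) z
  have him : (σ • z).im = z.im / Complex.normSq (w128 (σ 1 1) z) := by
    rw [ModularGroup.im_smul_eq_div_normSq, ModularGroup.denom_apply]
    congr 2
    rw [w128, hc]
    push_cast
    ring
  have hstar := const_identityK D hD3 (d := σ 1 1) haD ha hDm z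
  rw [hK, hθ, him]
  linear_combination (kerK D w z * shimuraTheta z ^ 3) * hstar

/-- Continuity of `z ↦ 𝒦_D(w, z)`. [folklore] -/
theorem continuous_kerK (w : ℍ) : Continuous fun z : ℍ ↦ kerK D w z :=
  continuous_genKernel32 (bddWeight_kohnenWt D) _ _ w

/-- **Automorphy of the Kohnen-type kernel**: for `D ≡ 3 (mod 4)` square-free, `z ↦ 𝒦_D(w, z)`
satisfies the `θ`-multiplier law of weight `3/2` on `Γ₀(128)` with TRIVIAL character.
[cite: Shintani1975, Prop. 1.6] -/
theorem isThetaAutomorphic_kerK (hsq : Squarefree D) (hD3 : D % 4 = 3) (w : ℍ) :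
    IsThetaAutomorphic 3 128 1 (fun z ↦ kerK D w z) := by
  have hodd : Odd D := Nat.odd_iff.mpr (by omega)
  have hχ : ∀ {x : ZMod 128}, IsUnit x → (1 : DirichletCharacter ℂ 128) x = 1 :=
    fun hx ↦ MulChar.one_apply hx
  refine isThetaAutomorphic_of_generators (continuous_kerK D w) (genSet32D D) ?_
    (gamma0_le_closure_genSet32D D hodd) ?_
  · intro σ hσ
    simp only [genSet32D, Set.mem_union, Set.mem_singleton_iff, Set.mem_setOf_eq] at hσ
    simp only [SetLike.mem_coe, CongruenceSubgroup.Gamma0_mem]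
    rcases hσ with (rfl | rfl) | ⟨h10, _⟩
    · simp [ModularGroup.T]
    · simp
    · rw [h10]
      decide
  · intro σ hσ z
    simp only [genSet32D, Set.mem_union, Set.mem_singleton_iff, Set.mem_setOf_eq] at hσ
    rcases hσ with (rfl | rfl) | ⟨h10, h00⟩
    · simp only
      rw [kerK_T_smul D hsq, shimuraTheta_T_smul]
      have : ((ModularGroup.T 1 1 : ℤ) : ZMod 128) = 1 := by simp [ModularGroup.T]
      rw [this, map_one]; ring
    · simp only
      rw [show ((-1 : SL(2, ℤ)) • z) = z from by rw [ModularGroup.SL_neg_smul, one_smul]]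
      have : (((-1 : SL(2, ℤ)) 1 1 : ℤ) : ZMod 128) = -1 := by simp
      rw [this, hχ isUnit_one.neg]; ring
    · simp only
      have hdet := det_eq_one' σ
      rw [h10] at hdet
      have hd : IsUnit ((σ 1 1 : ℤ) : ZMod 128) := by
        rw [ZMod.coe_int_isUnit_iff_isCoprime]
        refine ⟨-(σ 0 1 : ℤ), σ 0 0, ?_⟩
        push_cast
        linear_combination hdet
      rw [hχ hd, one_mul]
      exact kerK_sigma_law D hsq hD3 σ h10 h00 w z

end Law

end Literature.NumberTheory.EllipticCurves.Shintani
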